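import Literature.AnabelianGeometry.EtaleTheta.EtaleThetaDataOfClass
import Literature.AnabelianGeometry.EtaleTheta.ThetaCohomology
import Literature.AnabelianGeometry.EtaleTheta.ThetaLiftUnique
import HarnessLib

/-!
# [EtTh] Prop. 1.5 (iii) at `etaleThetaDataOfClass`: reduction of the typed `Prop15iii` to ONE lift of `η̈`
# with the `Z`-action law (proof-only; the model-side census/witness tool of the R78 value layer)

S. Mochizuki, *The étale theta function …*, Publ. RIMS **45** (2009), §1, Prop. 1.5 (iii) p. 23 (printed 249):
"Any class `η̈^Θ ∈ H¹(Π^tp_Ÿ, Δ_Θ)` arises from a unique class `η̈^Θ ∈ H¹((Π^tp_Ÿ)^Θ, Δ_Θ)` that maps to `log(Θ)`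
… on which `a ∈ Z` acts as follows: `η̈^Θ ↦ η̈^Θ − 2a·log(Ü) − (a²/2)·log(q_X) + log(O^×_K̈)`"
[cite: MochizukiEtTh2009, Prop 1.5 (iii) p.23]. Layer L2 of the abc-iut cell, seat abc-iut-L2-t6 (gen 5):
R78 cluster hand #4 (value layer; the stage-1 CENSUS of `Prop15iii` at `modelχ` and the stage-2 WITNESS at
`modelχq`, R78-MAP #5). PROOF-ONLY over the frozen predicate `ThetaSetting.Prop15iii` (abc-iut-L2-t1,
`ThetaCohomology.lean`), this seat's `KummerData.etaleThetaDataOfClass` (p427780) and abc-iut-L2-t12's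
`inflTheta_injective` (`ThetaLiftUnique.lean`) — consumed BY NAME; no definition, no `Prop` fact.

RESULT `KummerData.prop15iii_etaleThetaDataOfClass_of_lift`: for the data built from a Kummer datum `E₀` and a
class `η`, the typed Prop. 1.5 (iii) HOLDS as soon as (a) `η` has a lift `x′ ∈ H¹((Π^tp_Ÿ)^Θ, Δ_Θ)` restricting
to `log(Θ)` on `Δ_Θ`, (b) the unit Kummer classes restrict trivially to `Δ_Θ` and are fixed by the conjugation
action of `Π^tp_X` (Prop. 1.5 (ii)-type inputs, theorems at the models), and (c) the `Z`-ACTION LAW holds for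
`x′` alone: `σ·x′ = x′ · log(Ü)^{−2a} · κ(q̈)^{−a²} · κ(u_σ)`, `a = toZ σ`. Uniqueness is automatic
(`inflTheta` is injective), and the law for the other theta classes `κ(u)·η` follows from (b). So the clause
reduces to ONE explicit identity about ONE class — the shape in which abc-iut-L2-t12's normal-form computation
(`ThetaDeckConjugation`) delivers it at the Tate-sheared model, and in which it FAILS at the split model.
HONEST FRAMING: a reduction, asserting nothing about any model; typed ≠ proved; no side taken on [IUTchIII]
Cor. 3.12.
-/

noncomputable section

namespace Literature.AnabelianGeometry.EtaleTheta

namespace ThetaSetting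

namespace KummerData

variable {p : ℕ} [Fact p.Prime] {D : ThetaSetting p} (E₀ : D.KummerData) (η : D.H1 D.GtpYdd)

/-- The theta classes of `etaleThetaDataOfClass E₀ η` are the `infl κ(u) · η`, `u ∈ O^×_K̈`.
[cite: MochizukiEtTh2009, Prop 1.3 p.21] -/
theorem mem_thetaClasses_etaleThetaDataOfClass_iff (x : D.H1 D.GtpYdd) :
    x ∈ (E₀.etaleThetaDataOfClass η).thetaClasses ↔
      ∃ u ∈ D.unitsOKdd, x = D.inflTheta D.GtpYdd (E₀.kumYdd (E₀.toKddHat u)) * η := by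
  constructor
  · rintro ⟨k, hk, rfl⟩
    obtain ⟨c, ⟨u, hu, rfl⟩, rfl⟩ := hk
    exact ⟨u, hu, rfl⟩
  · rintro ⟨u, hu, rfl⟩
    exact ⟨_, ⟨E₀.toKddHat u, ⟨u, hu, rfl⟩, rfl⟩, rfl⟩

/-- **Prop. 1.5 (iii) from ONE lift with the `Z`-action law.** [cite: MochizukiEtTh2009, Prop 1.5 (iii) p.23] -/
theorem prop15iii_etaleThetaDataOfClass_of_lift (hC : D.Compat)
    (x' : D.H1Theta (D.GtpYdd.map D.toTheta)) (hx' : D.inflTheta D.GtpYdd x' = η)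
    (hres : ContH1.res (MonoidHom.id D.GtpTheta) D.DeltaTheta
      (hC.deltaTheta_le_DtpYddTheta.trans (Subgroup.map_mono inf_le_left)) x' = D.logTheta)
    (hkres : ∀ u ∈ D.unitsOKdd, ContH1.res (MonoidHom.id D.GtpTheta) D.DeltaTheta
      (hC.deltaTheta_le_DtpYddTheta.trans (Subgroup.map_mono inf_le_left)) (E₀.kumYdd (E₀.toKddHat u)) = 1)
    (hkconj : haveI := hC.GtpYddTheta_normal
      ∀ (σ : D.PiTemp), ∀ u ∈ D.unitsOKdd,
        ContH1.conj (MonoidHom.id D.GtpTheta) D.DeltaTheta (D.toTheta σ) (E₀.kumYdd (E₀.toKddHat u)) =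
          E₀.kumYdd (E₀.toKddHat u))
    (hconj : haveI := hC.GtpYddTheta_normal
      ∀ σ : D.PiTemp, ∃ u ∈ D.unitsOKdd,
        ContH1.conj (MonoidHom.id D.GtpTheta) D.DeltaTheta (D.toTheta σ) x' =
          x' * E₀.logUdd ^ (-(2 * Multiplicative.toAdd (D.toZ σ)))
             * E₀.kumYdd (E₀.toKddHat D.qddUnit) ^
                (-(Multiplicative.toAdd (D.toZ σ) * Multiplicative.toAdd (D.toZ σ)))
             * E₀.kumYdd (E₀.toKddHat u)) :
    Prop15iii (E₀.etaleThetaDataOfClass η) hC := by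
  haveI := hC.GtpYddTheta_normal
  intro x hx
  obtain ⟨v, hv, rfl⟩ := (E₀.mem_thetaClasses_etaleThetaDataOfClass_iff η x).mp hx
  -- the lift of `κ(v) · η` is `κ(v) · x'`
  refine ⟨E₀.kumYdd (E₀.toKddHat v) * x', ⟨?_, ?_, ?_⟩, ?_⟩
  · rw [map_mul, hx']
  · have h1 := (ContH1.res (MonoidHom.id D.GtpTheta) D.DeltaTheta
      (hC.deltaTheta_le_DtpYddTheta.trans (Subgroup.map_mono inf_le_left))).map_mul
      (E₀.kumYdd (E₀.toKddHat v)) x'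
    rw [hkres v hv, hres, one_mul] at h1
    exact h1
  · intro σ
    obtain ⟨u, hu, hσ⟩ := hconj σ
    refine ⟨u, hu, ?_⟩
    rw [map_mul, hkconj σ v hv, hσ]
    simp only [toKummerData_etaleThetaDataOfClass, mul_assoc]
    rfl
  · -- uniqueness: `inflTheta` is injective
    rintro y ⟨hy, -, -⟩
    apply D.inflTheta_injective D.GtpYdd
    rw [hy, map_mul, hx']

end KummerData

end ThetaSetting

end Literature.AnabelianGeometry.EtaleTheta

end
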